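import Literature.NumberTheory.GaloisRepresentations.CMTypeHeckeCharacter
import HarnessLib

/-!
# X11b @ `p = 3`, S24-a (λ-supply), part (A): the CHARACTERS — an algebraic Hecke character `Ψ`
# of an imaginary quadratic field, unramified outside `p`, with `Ψ · (Ψ ∘ c)⁻¹` unitary of
# infinity type `(1, −1)`

HONEST FRAMING (cell `b2b-bsdres`, run/shared/lean/b2b/bsd-rank1-residual/, verbatim in every
file): the goal of the cell is to DELETE the COMBINATION-SHAPED residual classes of the
Birch–Swinnerton-Dyer formula for ALL analytic-rank `≤ 1` elliptic curves over `ℚ` — assembled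
STRICTLY from published theorems — so that the rank-`≤ 1` remainder becomes exactly the
CONSTRUCTION-SHAPED classes, which are TYPED, NOT attempted. This is not "finishing BSD". Team N8/O2
(X11b at `3`: `3 ‖ N`, `r_an = 1`, `E[3]` irreducible): research route; nothing booked; NO label
changes; O2 stays OPEN (H45: S24 makes the (λ)-conjunct of `Three.HsiehFrameResidualAt₃` a CFT
theorem target; the open content is unchanged). THEOREMS ONLY (Hecke characters over the tree's
PROVED Weil existence theorem); no definition, no fact, no `sorry`.

PROVENANCE: sub-target S24 'λ-SUPPLY SPLIT' (OWNERS R7-59 / R7-66 / R8-4 / R8-16; S24 owner seat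
`b2b-bsdres-x11b3-p7`), part **(A) "Characters"** of p7's feasibility census
(`HOME/b2b-bsdres-x11b3-p7/s24/S24-FEASIBILITY.md` §2 (A)), dealt to seat `b2b-bsdres-x11b3-p2`
(gen. 4) by p7's offer (OWNERS 2026-08-21 l.640; SPEC in HOME/INBOX.md l.3658 (2)) — the statement
below is that SPEC (general `p ≥ 2`; `c` = complex conjugation as a `ℚ`-automorphism,
`(IsCMField.complexConj K).restrictScalars ℚ`, for which `HeckeCharacter.galConj` agrees
DEFINITIONALLY with the `K⁺`-linear `IsCMField.complexConj K` of
`HasInfinityType.galConj_complexConj` — `LambdaSupply.galConj_restrictScalars`,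
`X11b/Three/LambdaSupplyTransport.lean`). Siblings: (E) `LambdaSupplyRankTwo`, (D)
`LambdaSupplyPadicUnits` / `…Teichmueller` / `…LogCoordinates`, (B) `LambdaSupplyAvatar`, (C)
`LambdaSupplyTransport` / `LambdaSupplyQuotient`; consumer (F) `LambdaSupply` (p7).

## What this file proves (`K` a number field; §3 for `K` imaginary quadratic = CM with `[K:ℚ] = 2`)

* §1 `ideleNorm_smul`: `‖σ • x‖ = ‖x‖` (Galois invariance of the idele norm, over
  `Automorphic/GaloisActionAdeleRing`; = `Automorphic.IdeleNormGalConj`'s statement in the `σ • x`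
  spelling, re-proved for import hygiene); `exists_heckeCharacter_sqrt_ideleNorm`: the Hecke
  character `‖·‖^{1/2}` (`N x = √‖x‖`), with `isUnramifiedAt_of_sqrt` (a norm twist, unramified
  everywhere), `sqrt_apply_smul` (Galois invariant), `norm_sqrt_apply`, `sqrt_apply_infiniteIdeles`.
* §2 imaginary quadratic bookkeeping: one infinite place (`subsingleton_infinitePlace`,
  `mult_eq_two`), `apply_sq_eq_abs_norm` (`w(y)² = |N(y)|`),
  `apply_units_eq_one` (`w(u) = 1` on units) and **`units_eq_one_of_sub_one_mem_span`**: a unit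
  `≡ 1 (mod n)`, `n ≥ 3`, is `1` (`|N(u−1)| = w(u−1)² ≤ 4 < 9 ≤ n² ∣ N(u−1)`) — Weil's unit
  hypothesis for the modulus `(p²)`, with NO condition on `w_K`.
* §3 **`exists_character_quotient_type_one`** (part (A)): for `K` CM with `[K:ℚ] = 2` and `p ≥ 2`
  there is a Hecke character `Ψ` with `Ψ.IsAlgebraic`, `Ψ` unramified at every `v ∌ p`,
  `Ψ · (Ψ ∘ c)⁻¹` unitary and of infinity type `(1, −1)` (`HasInfinityType (fun _ ↦ 1) (fun _ ↦ -1)`);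
  `…_three` the `p = 3` instance; and `mul_galConj_inv_apply_ideleBaseChange`: `χ · (χ ∘ σ)⁻¹` is
  trivial on the ideles of the base field (`AdeleRing.smul_ideleBaseChange`). Construction:
  `Ψ := χ₀ · ‖·‖^{1/2}` with `χ₀` from `HeckeCharacter.exists_isUnitary_infiniteIdeles_eq_unramified`
  (Weil 1956 / CHT Lemma 4.1.4, PROVED in the tree) for `Φ(x) = (ι x_w/|ι x_w|)⁻¹ = x̄_w/|x_w|`
  (`exists_continuousMonoidHom_archUnitaryValue (-1) 0`) and `𝔞 = (p²)`; `Ψ((x,1)) = x̄_w` is type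
  `(0,−1)`, `Ψ ∘ c` type `(−1,0)`, the quotient type `(1,−1)`, unitary since `|χ₀| = 1` and
  `‖c • x‖ = ‖x‖`.

How (F) gets `[IsCMField K]` from `IsImaginaryQuadratic K = (finrank ℚ K = 2 ∧ IsTotallyComplex K)`:
`haveI : Algebra.IsQuadraticExtension ℚ K := ⟨hK⟩; IsCMField.ofCMExtension ℚ K` (Mathlib).

## References

* A. Weil, *On a certain type of characters of the idèle-class group of an algebraic
  number-field*, Proc. Int. Symp. Tokyo–Nikko 1955 (1956), 1–7, §1. [Weil1956]
* L. Clozel, M. Harris, R. Taylor, *Automorphy for some ℓ-adic lifts of automorphic mod ℓ Galois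
  representations*, Publ. Math. IHÉS 108 (2008), Lemma 4.1.4. [ClozelHarrisTaylor2008]
* J. Tate, *Fourier analysis in number fields and Hecke's zeta-functions* (1950), in
  Cassels–Fröhlich (1967), §4.3 (the quasi-characters `|𝔞|^s`), Lemma 2.3.1. [TateThesis1967]
* E. de Shalit, *Iwasawa theory of elliptic curves with complex multiplication* (1987), II.1.4
  (Grössencharacters of type `(1,0)`/`(k,j)` of an imaginary quadratic field). [deShalit1987]
-/

noncomputable section

open scoped NumberField ComplexConjugate NNReal
open NumberField IsDedekindDomain NumberField.InfinitePlace NumberField.InfinitePlace.Completion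
  Literature.NumberTheory.GaloisRepresentations Literature.NumberTheory.Automorphic

namespace Summit.BirchSwinnertonDyer.Rank1Residual.X11b.Three.LambdaSupply

/-! ### §1. The idele norm is Galois invariant; the square root of the norm character -/

section Norm

variable {F K : Type} [Field F] [Field K] [NumberField K] [Algebra F K]

/-- **`‖σ • x‖ = ‖x‖`** for an idele `x` of `K` and `σ ∈ Aut(K/F)` (the archimedean and the finite
factors of the idele norm are permuted by `w ↦ σ • w`, with equal local degrees / residue
cardinalities). This is `Automorphic.ideleNorm_unitsMap_galRingHom` (`IdeleNormGalConj.lean`) in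
the `σ • x` spelling of `HeckeCharacter.galConj`; re-proved here (ten lines over
`GaloisActionAdeleRing`) so that the automorphic `GL_n` files stay out of this import closure.
[folklore] -/
theorem ideleNorm_smul (σ : K ≃ₐ[F] K) (x : ideleGroup K) : ideleNorm (σ • x) = ideleNorm x := by
  have hx : ((σ • x : ideleGroup K) : AdeleRing (𝓞 K) K) = σ • (x : AdeleRing (𝓞 K) K) := rfl
  simp only [ideleNorm, hx, AdeleRing.smul_fst, AdeleRing.smul_snd]
  congr 1
  · refine (Fintype.prod_equiv (MulAction.toPerm σ) _ _ fun w => ?_).symm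
    have hmult : (σ • w).mult = w.mult := by
      by_cases h : w.IsReal
      · rw [InfinitePlace.mult, InfinitePlace.mult, if_pos h,
          if_pos (NumberField.InfinitePlace.isReal_smul_iff.mpr h)]
      · rw [InfinitePlace.mult, InfinitePlace.mult, if_neg h,
          if_neg fun h' => h (NumberField.InfinitePlace.isReal_smul_iff.mp h')]
    rw [MulAction.toPerm_apply, InfiniteAdeleRing.norm_smul_apply_smul, hmult]
  · refine (finprod_eq_of_bijective (fun v : HeightOneSpectrum (𝓞 K) => σ • v)
      (MulAction.bijective σ) fun v => ?_).symm
    rw [FiniteAdeleRing.smul_apply_smul, FinitePlace.norm_def, FinitePlace.norm_def,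
      valued_galAdicCompletionMap]
    have h : (Ideal.absNorm (σ • v).asIdeal : ℝ≥0) = Ideal.absNorm v.asIdeal := by
      rw [HeightOneSpectrum.absNorm_algEquiv_smul F σ v]
    simp only [h]

variable (K) in
/-- **The square root `‖·‖^{1/2}` of the norm character** as a Hecke character: a continuous
homomorphism `𝕀_K → ℂˣ` (the idelic norm `Automorphic.ideleNormUnits` followed by
`√· : ℝ_{>0} → ℝ_{>0} ⊂ ℂˣ`, Mathlib `NNReal.sqrtHom`), trivial on `Kˣ` by the product formula.
Tate's quasi-character `|𝔞|^{1/2}` (Tate 1950 §4.3; the complex powers `‖·‖^z` are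
`HeckeCharacter.exists_forall_apply_eq_ideleNorm_cpow` (`HeckeLFunctionNonvanishingLineProofs`) and
`Automorphic.exists_heckeCharacter_ideleNorm_cpow` (`IdeleNormDetGL`) — neither imported, to keep
L-function analysis / automorphic `GL_n` out of this closure; the real square root is all (A) needs).
[cite: TateThesis1967, §4.3] -/
theorem exists_heckeCharacter_sqrt_ideleNorm :
    ∃ N : HeckeCharacter K, ∀ x : ideleGroup K,
      ((N x : ℂˣ) : ℂ) = ((Real.sqrt (ideleNorm x) : ℝ) : ℂ) := by
  let f : ℝ≥0 →* ℂ :=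
    (Complex.ofRealHom : ℝ →+* ℂ).toMonoidHom.comp
      (NNReal.toRealHom.toMonoidHom.comp (NNReal.sqrtHom : ℝ≥0 →*₀ ℝ≥0).toMonoidHom)
  have hf : Continuous f :=
    Complex.continuous_ofReal.comp (NNReal.continuous_coe.comp NNReal.continuous_sqrt)
  have hn : Continuous (Literature.NumberTheory.Automorphic.ideleNormUnits K) :=
    Units.continuous_iff.mpr ⟨Literature.NumberTheory.Automorphic.continuous_ideleNorm_holds K,
      ((Literature.NumberTheory.Automorphic.continuous_ideleNorm_holds K).comp continuous_inv).congr
        fun _ => rfl⟩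
  let φ : ideleGroup K →ₜ* ℂˣ :=
    ⟨(Units.map f).comp (Literature.NumberTheory.Automorphic.ideleNormUnits K),
      (Continuous.units_map f hf).comp hn⟩
  have hφ : ∀ x : ideleGroup K, ((φ x : ℂˣ) : ℂ) =
      (((NNReal.sqrt (Literature.NumberTheory.Automorphic.IdeleClassGroup.ideleNorm K x) : ℝ≥0) :
        ℝ) : ℂ) := fun x => rfl
  refine ⟨{ toContinuousMonoidHom := φ, map_principal' := fun x hx => ?_ }, fun x => ?_⟩
  · refine Units.ext ?_
    change ((φ x : ℂˣ) : ℂ) = 1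
    rw [hφ, Literature.NumberTheory.Automorphic.ideleNorm_principal hx, NNReal.sqrt_one, NNReal.coe_one,
      Complex.ofReal_one]
  · change ((φ x : ℂˣ) : ℂ) = _
    rw [hφ, Real.coe_sqrt, Literature.NumberTheory.Automorphic.coe_ideleNorm]

variable {N : HeckeCharacter K}
  (hN : ∀ x : ideleGroup K, ((N x : ℂˣ) : ℂ) = ((Real.sqrt (ideleNorm x) : ℝ) : ℂ))
include hN

/-- `‖·‖^{1/2}` is a norm twist (`z = 1/2`), hence unramified everywhere
(`HeckeCharacter.IsNormTwist.isUnramifiedAt_holds`). [cite: TateThesis1967, Lemma 2.3.1] -/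
theorem isUnramifiedAt_of_sqrt (v : HeightOneSpectrum (𝓞 K)) : N.IsUnramifiedAt v := by
  refine HeckeCharacter.IsNormTwist.isUnramifiedAt_holds ⟨((1 / 2 : ℝ) : ℂ), fun x => ?_⟩ v
  -- `0 ≤ ‖x‖` (indeed `0 < ‖x‖`, `HeckeCharacter.ideleNorm_pos'` of
  -- `HeckeLFunctionNonvanishingLineProofs`, not imported: L-function analysis)
  have hx : 0 ≤ ideleNorm x := by
    rw [← Literature.NumberTheory.Automorphic.coe_ideleNorm]; exact NNReal.coe_nonneg _
  rw [hN x, Real.sqrt_eq_rpow, Complex.ofReal_cpow hx]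

/-- `‖·‖^{1/2}` is Galois invariant: `N(σ • x) = N(x)`. [folklore] -/
theorem sqrt_apply_smul (σ : K ≃ₐ[F] K) (x : ideleGroup K) : N (σ • x) = N x :=
  Units.ext (by rw [hN, hN, ideleNorm_smul])

/-- `|N(x)| = √‖x‖`. [folklore] -/
theorem norm_sqrt_apply (x : ideleGroup K) : ‖((N x : ℂˣ) : ℂ)‖ = Real.sqrt (ideleNorm x) := by
  rw [hN x, Complex.norm_real, Real.norm_eq_abs, abs_of_nonneg (Real.sqrt_nonneg _)]

/-- On an infinite idele `(x, 1)`: `N((x,1)) = √(∏_w ‖x_w‖^{[K_w:ℝ]})`. [folklore] -/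
theorem sqrt_apply_infiniteIdeles (x : (InfiniteAdeleRing K)ˣ) :
    ((N (infiniteIdeles K x) : ℂˣ) : ℂ) =
      ((Real.sqrt (∏ w : InfinitePlace K, ‖(x : InfiniteAdeleRing K) w‖ ^ w.mult) : ℝ) : ℂ) := by
  rw [hN, HeckeCharacter.ideleNorm_infiniteIdeles']

end Norm

/-! ### §2. Imaginary quadratic fields: the infinite place, units congruent to `1` -/

section Quadratic

variable {K : Type} [Field K] [NumberField K]

/-- An imaginary quadratic field has exactly one infinite place (`r₁ + 2 r₂ = 2`, `r₁ = 0`; the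
cardinality statement is `WeierstrassCurve.card_infinitePlace_eq_one_of_finrank_eq_two` of
`EllipticCurves/ComplexPeriod`, not imported here), so its infinite places form a subsingleton.
[folklore] -/
theorem subsingleton_infinitePlace (hK : Module.finrank ℚ K = 2) [IsTotallyComplex K] :
    Subsingleton (InfinitePlace K) := by
  refine Fintype.card_le_one_iff_subsingleton.mp (le_of_eq ?_)
  have h1 := card_add_two_mul_card_eq_rank K
  have h0 : nrRealPlaces K = 0 := nrRealPlaces_eq_zero_iff.mpr inferInstance
  rw [card_eq_nrRealPlaces_add_nrComplexPlaces]
  omega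

omit [NumberField K] in
/-- In a totally complex field every infinite place has local degree `[K_w : ℝ] = 2`. [folklore] -/
theorem mult_eq_two [IsTotallyComplex K] (w : InfinitePlace K) : w.mult = 2 := by
  rw [InfinitePlace.mult, if_neg (not_isReal_iff_isComplex.mpr (IsTotallyComplex.isComplex w))]

/-- `|N_{K/ℚ}(y)| = w(y)²` for the infinite place `w` of an imaginary quadratic field
(Mathlib `InfinitePlace.prod_eq_abs_norm` with one factor of multiplicity `2`). [folklore] -/
theorem apply_sq_eq_abs_norm (hK : Module.finrank ℚ K = 2) [IsTotallyComplex K] (w : InfinitePlace K)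
    (y : K) : w y ^ 2 = |((Algebra.norm ℚ y : ℚ) : ℝ)| := by
  haveI := subsingleton_infinitePlace hK
  have h := prod_eq_abs_norm y
  rw [Fintype.prod_subsingleton _ w, mult_eq_two] at h
  rw [h, Rat.cast_abs]

/-- A unit of an imaginary quadratic field has absolute value `1` at the infinite place
(`w(u)² = |N(u)| = 1`). [folklore] -/
theorem apply_units_eq_one (hK : Module.finrank ℚ K = 2) [IsTotallyComplex K] (w : InfinitePlace K)
    (u : (𝓞 K)ˣ) : w ((u : 𝓞 K) : K) = 1 := by
  have hsq := apply_sq_eq_abs_norm hK w ((u : 𝓞 K) : K)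
  have hunit : IsUnit (Algebra.norm ℤ (u : 𝓞 K)) := (Units.isUnit u).map (Algebra.norm ℤ)
  have h1 : |((Algebra.norm ℚ ((u : 𝓞 K) : K) : ℚ) : ℝ)| = 1 := by
    rw [← Algebra.coe_norm_int, Rat.cast_intCast, ← Int.cast_abs, Int.isUnit_iff_abs_eq.mp hunit,
      Int.cast_one]
  rw [h1] at hsq
  exact (pow_eq_one_iff_of_nonneg (apply_nonneg w _) two_ne_zero).mp hsq

/-- **Units congruent to `1` modulo `n ≥ 3` are trivial** in an imaginary quadratic field: if
`u ∈ 𝓞_Kˣ` and `u − 1 ∈ (n)` then `u = 1`. (The units are roots of unity `ζ`, and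
`|N(ζ − 1)| = w(ζ − 1)² ≤ (w(ζ) + 1)² = 4 < 9 ≤ n² = N((n)) ≤ |N(ζ − 1)|` unless `ζ = 1`.) This is
the unit hypothesis of Weil's existence theorem
(`HeckeCharacter.exists_isUnitary_infiniteIdeles_eq_unramified`) for the modulus `(p²)` — no
condition on the number `w_K` of roots of unity. [folklore] -/
theorem units_eq_one_of_sub_one_mem_span (hK : Module.finrank ℚ K = 2) [IsTotallyComplex K]
    {n : ℕ} (hn : 3 ≤ n) (u : (𝓞 K)ˣ)
    (hu : (u : 𝓞 K) - 1 ∈ Ideal.span {((n : ℕ) : 𝓞 K)}) : u = 1 := by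
  by_contra hne
  haveI := subsingleton_infinitePlace hK
  obtain ⟨w⟩ : Nonempty (InfinitePlace K) := inferInstance
  set x : 𝓞 K := (u : 𝓞 K) - 1 with hxdef
  have hx0 : x ≠ 0 := by
    intro h
    apply hne
    rw [hxdef, sub_eq_zero] at h
    exact Units.ext h
  -- `n² ∣ N(x)` and `N(x) ≠ 0`, so `n² ≤ |N(x)|`
  have hdvd : ((n ^ 2 : ℕ) : ℤ) ∣ Algebra.norm ℤ x := by
    have h := Ideal.absNorm_dvd_norm_of_mem hu
    rwa [Ideal.absNorm_span_natCast, NumberField.RingOfIntegers.rank, hK] at h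
  have hN0 : Algebra.norm ℤ x ≠ 0 := Algebra.norm_ne_zero_iff.mpr hx0
  have hle : (n : ℤ) ^ 2 ≤ |Algebra.norm ℤ x| := by
    rw [← Nat.cast_pow]
    exact Int.le_of_dvd (abs_pos.mpr hN0) ((dvd_abs _ _).mpr hdvd)
  -- `|N(x)| = w(x)² ≤ 4`
  have hwx : w (x : K) ≤ 2 := by
    have hsub : ((x : 𝓞 K) : K) = ((u : 𝓞 K) : K) - 1 := by rw [hxdef]; push_cast; ring
    rw [hsub]
    calc w (((u : 𝓞 K) : K) - 1) ≤ w ((u : 𝓞 K) : K) + w 1 := w.val.sub_le_add _ _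
      _ = 2 := by rw [apply_units_eq_one hK w u, map_one]; norm_num
  have habs : |((Algebra.norm ℤ x : ℤ) : ℝ)| ≤ 4 := by
    rw [← Rat.cast_intCast, Algebra.coe_norm_int, ← apply_sq_eq_abs_norm hK w]
    nlinarith [apply_nonneg w (x : K)]
  have hle' : ((n : ℤ) : ℝ) ^ 2 ≤ 4 := by
    have := (Int.cast_le (R := ℝ)).mpr hle
    rw [Int.cast_pow, Int.cast_abs] at this
    exact this.trans habs
  have hn' : (3 : ℝ) ≤ ((n : ℤ) : ℝ) := by exact_mod_cast hn
  nlinarith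

end Quadratic

/-! ### §3. The character `Ψ` -/

section Construction

variable {K : Type} [Field K] [NumberField K]

/-- The archimedean value `(z/|z|)⁻¹ · |z|^{0·i} · |z| = z̄` behind the type computation:
`archUnitaryValue (-1) 0 z * ‖z‖ = conj z` for `z ≠ 0`. [folklore] -/
theorem archUnitaryValue_neg_one_zero_mul_norm {z : ℂ} (hz : z ≠ 0) :
    archUnitaryValue (-1) 0 z * (‖z‖ : ℂ) = conj z := by
  rw [archUnitaryValue, Complex.ofReal_zero, zero_mul, Complex.cpow_zero, mul_one, zpow_neg_one,
    inv_div, div_mul_eq_mul_div, div_eq_iff hz, mul_comm ((starRingEnd ℂ) z) z, Complex.mul_conj', sq]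

/-- **Part (A) of the λ-supply.** Let `K` be an imaginary quadratic field (a CM field with
`[K : ℚ] = 2`), `c` its complex conjugation (as a `ℚ`-automorphism) and `p ≥ 2`. There is a Hecke
character `Ψ` of `K` which is ALGEBRAIC (infinity type `(0, −1)`: `Ψ((x,1)) = x̄_w`), UNRAMIFIED
OUTSIDE `p`, and whose quotient `Ψ · (Ψ ∘ c)⁻¹` is UNITARY of infinity type `(1, −1)`.
Construction: Weil's existence theorem (`HeckeCharacter.exists_isUnitary_infiniteIdeles_eq_unramified`)
for the unitary archimedean character `z ↦ z̄/|z|` and the modulus `(p²)` — its unit hypothesis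
holds because a unit `≡ 1 (mod p²)` of an imaginary quadratic field is `1`
(`units_eq_one_of_sub_one_mem_span`) — gives a unitary `χ₀` with `χ₀((x,1)) = x̄_w/|x_w|`,
unramified outside `p`; then `Ψ := χ₀ · ‖·‖^{1/2}` (`exists_heckeCharacter_sqrt_ideleNorm`) has
`Ψ((x,1)) = x̄_w` (type `(0,−1)`), `Ψ ∘ c` has type `(−1, 0)`
(`HasInfinityType.galConj_complexConj`), so the quotient has type `(1,−1)`; it is unitary because
`χ₀` is and `‖c • x‖ = ‖x‖` (`ideleNorm_smul`). [cite: Weil1956, §1] -/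
theorem exists_character_quotient_type_one [IsCMField K] (hK : Module.finrank ℚ K = 2)
    {p : ℕ} (hp : 2 ≤ p) :
    ∃ Ψ : HeckeCharacter K, Ψ.IsAlgebraic ∧
      (∀ v : HeightOneSpectrum (𝓞 K), ((p : ℕ) : 𝓞 K) ∉ v.asIdeal → Ψ.IsUnramifiedAt v) ∧
      (Ψ * (HeckeCharacter.galConj ((IsCMField.complexConj K).restrictScalars ℚ) Ψ)⁻¹).IsUnitary ∧
      (Ψ * (HeckeCharacter.galConj ((IsCMField.complexConj K).restrictScalars ℚ) Ψ)⁻¹).HasInfinityType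
        (fun _ ↦ (1 : ℤ)) (fun _ ↦ (-1 : ℤ)) := by
  classical
  haveI := subsingleton_infinitePlace hK
  -- the archimedean character `Φ(x) = ∏_w (ι_w x_w / |ι_w x_w|)⁻¹ = x̄_w / |x_w|`
  obtain ⟨Φ, hΦ⟩ := exists_continuousMonoidHom_archUnitaryValue (K := K) (fun _ => -1) (fun _ => 0)
  have h0 : ∀ (x : (InfiniteAdeleRing K)ˣ) (w : InfinitePlace K),
      extensionEmbedding w ((x : InfiniteAdeleRing K) w) ≠ 0 :=
    fun x w => InfiniteIdele.extensionEmbedding_apply_ne_zero x w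
  have hΦu : ∀ x, ‖(Φ x : ℂ)‖ = 1 := fun x => by
    rw [hΦ x, norm_prod]
    exact Finset.prod_eq_one fun w _ => norm_archUnitaryValue (h0 x w) _ _
  -- the modulus `(p²)` and Weil's unit hypothesis
  have hp2 : (3 : ℕ) ≤ p ^ 2 := by nlinarith
  have h𝔞 : Ideal.span {((p ^ 2 : ℕ) : 𝓞 K)} ≠ ⊥ := by
    rw [Ne, Ideal.span_singleton_eq_bot]
    exact_mod_cast (pow_pos (by omega : 0 < p) 2).ne'
  have hker : ∀ u : (𝓞 K)ˣ, (u : 𝓞 K) - 1 ∈ Ideal.span {((p ^ 2 : ℕ) : 𝓞 K)} →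
      Φ (globalToInfiniteUnits K (Units.map (algebraMap (𝓞 K) K : 𝓞 K →* K) u)) = 1 := by
    intro u hu
    rw [units_eq_one_of_sub_one_mem_span hK hp2 u hu, map_one, map_one, map_one]
  obtain ⟨χ₀, hχ₀u, hχ₀Φ, hχ₀unr⟩ :=
    HeckeCharacter.exists_isUnitary_infiniteIdeles_eq_unramified Φ hΦu h𝔞 hker
  -- the square root of the norm character
  obtain ⟨N, hN⟩ := exists_heckeCharacter_sqrt_ideleNorm K
  -- `Ψ := χ₀ · ‖·‖^{1/2}` has infinity type `(0, -1)`
  set Ψ : HeckeCharacter K := χ₀ * N with hΨdef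
  have hΨtype : Ψ.HasInfinityType (fun _ ↦ (0 : ℤ)) (fun _ ↦ (-1 : ℤ)) := by
    refine ⟨Set.univ, Filter.univ_mem, fun x _ => ?_⟩
    obtain ⟨w⟩ : Nonempty (InfinitePlace K) := inferInstance
    have hz := h0 x w
    rw [hΨdef, HeckeCharacter.mul_apply, Units.val_mul, hχ₀Φ, hΦ, sqrt_apply_infiniteIdeles hN,
      HeckeCharacter.archFactor_apply, Fintype.prod_subsingleton _ w, Fintype.prod_subsingleton _ w,
      Fintype.prod_subsingleton _ w, mult_eq_two, Real.sqrt_sq (norm_nonneg _),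
      ← (isometry_extensionEmbedding w).norm_map_of_map_zero (map_zero _) ((x : InfiniteAdeleRing K) w),
      archUnitaryValue_neg_one_zero_mul_norm hz, neg_zero, zpow_zero, one_mul, neg_neg, zpow_one]
  -- the conjugate has type `(-1, 0)` and the quotient type `(1, -1)`
  have hΨc : (HeckeCharacter.galConj ((IsCMField.complexConj K).restrictScalars ℚ) Ψ).HasInfinityType
      (fun _ ↦ (-1 : ℤ)) (fun _ ↦ (0 : ℤ)) :=
    hΨtype.galConj_complexConj
  have hquot := hΨtype.mul' hΨc.inv
  have e1 : ((fun _ : InfinitePlace K ↦ (0 : ℤ)) + -fun _ : InfinitePlace K ↦ (-1 : ℤ)) =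
      fun _ ↦ (1 : ℤ) := by funext w; simp
  have e2 : ((fun _ : InfinitePlace K ↦ (-1 : ℤ)) + -fun _ : InfinitePlace K ↦ (0 : ℤ)) =
      fun _ ↦ (-1 : ℤ) := by funext w; simp
  rw [e1, e2] at hquot
  refine ⟨Ψ, (Ψ.isAlgebraic_iff_exists_hasInfinityType).mpr ⟨_, _, hΨtype⟩, fun v hv => ?_, ?_, hquot⟩
  · -- unramified outside `p`
    refine (hχ₀unr v fun hle => hv ?_).mul' (isUnramifiedAt_of_sqrt hN v)
    rw [Ideal.span_singleton_le_iff_mem, Nat.cast_pow] at hle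
    exact (v.isPrime.pow_mem_iff_mem 2 two_pos).mp hle
  · -- unitary: `|χ₀| = 1` and `‖c • x‖ = ‖x‖`
    intro y
    have hy : 0 < ideleNorm y := by
      rw [← Literature.NumberTheory.Automorphic.coe_ideleNorm]
      exact NNReal.coe_pos.2 (pos_iff_ne_zero.2 (Literature.NumberTheory.Automorphic.ideleNorm_ne_zero y))
    have hr : Real.sqrt (ideleNorm y) ≠ 0 := (Real.sqrt_pos.mpr hy).ne'
    rw [HeckeCharacter.mul_apply, HeckeCharacter.inv_apply, HeckeCharacter.galConj_apply, hΨdef,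
      HeckeCharacter.mul_apply, HeckeCharacter.mul_apply, sqrt_apply_smul hN, Units.val_mul,
      Units.val_inv_eq_inv_val, Units.val_mul, Units.val_mul, norm_mul, norm_inv, norm_mul, norm_mul,
      hχ₀u, hχ₀u, norm_sqrt_apply hN]
    simp [hr]

/-- **Part (A) at `p = 3`** (the instance consumed by the λ-supply at `3 ‖ N`): `Ψ` algebraic,
unramified at every `v ∌ 3`, `Ψ · (Ψ ∘ c)⁻¹` unitary of type `(1, −1)`. [cite: Weil1956, §1] -/
theorem exists_character_quotient_type_one_three [IsCMField K] (hK : Module.finrank ℚ K = 2) :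
    ∃ Ψ : HeckeCharacter K, Ψ.IsAlgebraic ∧
      (∀ v : HeightOneSpectrum (𝓞 K), ((3 : ℕ) : 𝓞 K) ∉ v.asIdeal → Ψ.IsUnramifiedAt v) ∧
      (Ψ * (HeckeCharacter.galConj ((IsCMField.complexConj K).restrictScalars ℚ) Ψ)⁻¹).IsUnitary ∧
      (Ψ * (HeckeCharacter.galConj ((IsCMField.complexConj K).restrictScalars ℚ) Ψ)⁻¹).HasInfinityType
        (fun _ ↦ (1 : ℤ)) (fun _ ↦ (-1 : ℤ)) :=
  exists_character_quotient_type_one hK (p := 3) (by norm_num)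

/-- **The quotient `χ · (χ ∘ σ)⁻¹` is trivial on the ideles of the base field** (base-changed
ideles are fixed by `σ`: `AdeleRing.smul_ideleBaseChange`), for every Hecke character `χ` of `K`
and every `σ ∈ Aut(K/F)` — the clause `λ(x_ℚ) = 1` of the λ-supply for `λ = Ψ · (Ψ ∘ c)⁻¹`.
[folklore] -/
theorem mul_galConj_inv_apply_ideleBaseChange {F : Type} [Field F] [NumberField F] [Algebra F K]
    (σ : K ≃ₐ[F] K) (χ : HeckeCharacter K) (x : ideleGroup F) :
    (χ * (HeckeCharacter.galConj σ χ)⁻¹) (AdeleRing.ideleBaseChange F K x) = 1 := by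
  rw [HeckeCharacter.mul_apply, HeckeCharacter.inv_apply, HeckeCharacter.galConj_apply,
    AdeleRing.smul_ideleBaseChange, mul_inv_cancel]

end Construction

end Summit.BirchSwinnertonDyer.Rank1Residual.X11b.Three.LambdaSupply

end
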